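import Literature.Probability.Percolation.RhombicTilingPlanarity
import HarnessLib

/-!
# Planarity of rhombic tilings, II: sides, oblique coordinates and supporting lines of a rhombus

Sequel to `RhombicTilingPlanarity` (convex geometry of the quadrilateral `A P B Q` with
`P + Q = A + B` and unit sides — the rhombus of an edge of an isoradial embedding, GM 2014 §2.1).
Every argument about the *planar structure* of a rhombic tiling (the rhombus on the other side
of a side, fault lines, de Bruijn's train tracks, fans around a corner; Grimmett–Manolescu 2014,
§4.1–4.2; Kenyon–Schlenker 2005, §3; de Bruijn 1981) rests on the elementary facts proved here
for one parallelogram `A P B Q` (`B = P + Q - A`) and its side `[A, P]`: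

* `sideFn A P X = Im ((X - A) conj (P - A))`, an affine functional vanishing exactly on the
  line `AP`; `cross_identity` (Cramer's rule in `ℝ²`);
* the **oblique coordinates** `coordP`, `coordQ` of a point (`Y = A + α (P - A) + β (Q - A)`,
  `eq_coord`), the description of the parallelogram as the unit square in these coordinates
  (`convexHull_quad_eq_coord`), of its side `[A, P]` (`segment_eq_coord`,
  `openSegment_eq_coord`) and of the inner half-plane of that side (`inner_iff_coordQ_nonneg`);
* **supporting half-plane** `convexHull_quad_subset_halfPlane` (the parallelogram lies in the
  closed half-plane of `B` bounded by the line `AP`) and **half-discs at open side points**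
  `exists_ball_inter_halfPlane_subset_quad` (near a point of the open side, that half-plane lies
  in the parallelogram, and its open half in the interior);
* topological bookkeeping: the parallelogram is closed, has non-empty interior and is the
  closure of its interior (`subset_closure_interior_quad`), whence `interior_inter_nonempty`
  (a set meeting the interior of a convex body `K'` at a point of a convex body `K` forces the
  two interiors to meet) — the form in which "disjoint interiors" is used throughout;
* **across a side** `subset_outer_of_mem_openSegment`: a second parallelogram with interior
  disjoint from the first and containing a point of the open side `(A, P)` lies in the closed
  *outer* half-plane of that side;
* **faces in a supporting line** `quad_face`: if the parallelogram lies in a closed half-plane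
  `{s · sideFn E₁ E₂ ≤ 0}` and meets the boundary line in two distinct points, then it meets it
  exactly in one of its sides `[C, C']`, `C ∈ {A, B}`, `C' ∈ {P, Q}`;
* collinearity bookkeeping on a line (`eq_add_real_mul_of_sideFn_eq_zero`, `sideFn_of_mem_line`).

The other three sides of `A P B Q` are the sides `[A', P']` of the re-labelled quadrilaterals
`(B, P, A, Q)`, `(B, Q, A, P)`, `(A, Q, B, P)`, which satisfy the same hypotheses
(`IsQuad.swapAB`, `IsQuad.swapPQ`) and have the same hull (`IsQuad.hull_swapAB`, `…_swapPQ`).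

## References

* G. R. Grimmett, I. Manolescu, *Bond percolation on isoradial graphs*, PTRF 159 (2014),
  arXiv:1204.0505, §2.1, §4.1.
* R. Kenyon, J.-M. Schlenker, *Rhombic embeddings of planar quad-graphs*, TAMS 357 (2005), §3.
* N. G. de Bruijn, *Algebraic theory of Penrose's non-periodic tilings of the plane*, Indag.
  Math. 43 (1981), §4 (the sides of the rhombi of a tiling).
-/

noncomputable section

namespace Literature.Probability.Percolation

open Complex ComplexConjugate Metric Set
open IsoradialCriticality

/-! ### The side functional and Cramer's rule -/

section SideFn

variable {A B P Q : ℂ}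

/-- **The side functional** of the directed side `A → P`: `Im ((X - A) · conj (P - A))`, zero
exactly on the line `AP` (for `A ≠ P`), of constant sign on each open half-plane. [folklore] -/
def sideFn (A P X : ℂ) : ℝ := ((X - A) * conj (P - A)).im

/-- The side functional vanishes at `A`. [folklore] -/
@[simp] theorem sideFn_left (A P : ℂ) : sideFn A P A = 0 := by simp [sideFn]

/-- The side functional vanishes at `P`. [folklore] -/
@[simp] theorem sideFn_right (A P : ℂ) : sideFn A P P = 0 := by
  unfold sideFn; rw [Complex.mul_conj]; exact Complex.ofReal_im _

/-- The side functional is affine: its value at an affine combination. [folklore] -/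
theorem sideFn_combo (A P X Y : ℂ) {u v : ℝ} (huv : u + v = 1) :
    sideFn A P (u • X + v • Y) = u * sideFn A P X + v * sideFn A P Y := by
  simp only [sideFn, Complex.real_smul]
  have hu : (u : ℂ) + (v : ℂ) = 1 := by exact_mod_cast huv
  have : ((u : ℂ) * X + (v : ℂ) * Y - A) * conj (P - A) =
      (u : ℂ) * ((X - A) * conj (P - A)) + (v : ℂ) * ((Y - A) * conj (P - A)) := by
    linear_combination (A * conj (P - A)) * hu
  rw [this, Complex.add_im, Complex.im_ofReal_mul, Complex.im_ofReal_mul]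

/-- The side functional along a translate: `sideFn A P (X + t • w) = sideFn A P X + t · Im (w conj (P - A))`.
[folklore] -/
theorem sideFn_add_smul (A P X w : ℂ) (t : ℝ) :
    sideFn A P (X + (t : ℂ) * w) = sideFn A P X + t * ((w * conj (P - A)).im) := by
  simp only [sideFn]
  have : (X + (t : ℂ) * w - A) * conj (P - A) =
      (X - A) * conj (P - A) + (t : ℂ) * (w * conj (P - A)) := by ring
  rw [this, Complex.add_im, Complex.im_ofReal_mul]

/-- Reversing the direction of the side changes the sign of the side functional:
`sideFn A P X` and `sideFn A X P` are opposite. [folklore] -/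
theorem sideFn_swap (A P X : ℂ) : sideFn A X P = -sideFn A P X := by
  simp only [sideFn]
  have : (P - A) * conj (X - A) = conj ((X - A) * conj (P - A)) := by
    rw [map_mul, Complex.conj_conj, mul_comm]
  rw [this, Complex.conj_im]

/-- The side functional is continuous in the point. [folklore] -/
theorem continuous_sideFn (A P : ℂ) : Continuous fun X => sideFn A P X := by
  unfold sideFn
  fun_prop

/-- **Cramer's rule in `ℝ² = ℂ`.** For vectors `p q w`:
`Im (p q̄) · w = Im (w q̄) · p - Im (w p̄) · q`. [folklore] -/
theorem cross_identity (p q w : ℂ) :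
    (((p * conj q).im : ℝ) : ℂ) * w =
      (((w * conj q).im : ℝ) : ℂ) * p - (((w * conj p).im : ℝ) : ℂ) * q := by
  apply Complex.ext <;>
    simp only [Complex.mul_re, Complex.mul_im, Complex.sub_re, Complex.sub_im,
      Complex.ofReal_re, Complex.ofReal_im, Complex.conj_re, Complex.conj_im] <;> ring

/-- On the line `AP` (`A ≠ P`) every point is `A` plus a *real* multiple of `P - A`.
[folklore] -/
theorem eq_add_real_mul_of_sideFn_eq_zero (hAP : A ≠ P) {X : ℂ} (hX : sideFn A P X = 0) :
    ∃ t : ℝ, X = A + (t : ℂ) * (P - A) := by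
  have hPA : P - A ≠ 0 := sub_ne_zero.2 hAP.symm
  refine ⟨((X - A) * conj (P - A)).re / Complex.normSq (P - A), ?_⟩
  have hn : (Complex.normSq (P - A) : ℂ) ≠ 0 := by
    exact_mod_cast (Complex.normSq_pos.2 hPA).ne'
  -- `(X - A) conj (P - A)` is real
  have hreal : (X - A) * conj (P - A) = ((((X - A) * conj (P - A)).re : ℝ) : ℂ) := by
    apply Complex.ext
    · simp
    · simp only [Complex.ofReal_im]; exact hX
  have key : (X - A) * (Complex.normSq (P - A) : ℂ) =
      ((((X - A) * conj (P - A)).re : ℝ) : ℂ) * (P - A) := by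
    rw [← Complex.mul_conj, ← hreal]; ring
  have : X - A = ((((X - A) * conj (P - A)).re / Complex.normSq (P - A) : ℝ) : ℂ) * (P - A) := by
    push_cast
    field_simp
    linear_combination key
  linear_combination this

/-- Three points on a line are collinear: if `X, Y, Z` lie on the line `E₁E₂` then
`sideFn X Y Z = 0`. [folklore] -/
theorem sideFn_of_mem_line {E₁ E₂ X Y Z : ℂ} (hE : E₁ ≠ E₂) (hX : sideFn E₁ E₂ X = 0)
    (hY : sideFn E₁ E₂ Y = 0) (hZ : sideFn E₁ E₂ Z = 0) : sideFn X Y Z = 0 := by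
  obtain ⟨x, rfl⟩ := eq_add_real_mul_of_sideFn_eq_zero hE hX
  obtain ⟨y, rfl⟩ := eq_add_real_mul_of_sideFn_eq_zero hE hY
  obtain ⟨z, rfl⟩ := eq_add_real_mul_of_sideFn_eq_zero hE hZ
  simp only [sideFn]
  have h1 : E₁ + (z : ℂ) * (E₂ - E₁) - (E₁ + (x : ℂ) * (E₂ - E₁)) = ((z - x : ℝ) : ℂ) * (E₂ - E₁) := by
    push_cast; ring
  have h2 : E₁ + (y : ℂ) * (E₂ - E₁) - (E₁ + (x : ℂ) * (E₂ - E₁)) = ((y - x : ℝ) : ℂ) * (E₂ - E₁) := by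
    push_cast; ring
  rw [h1, h2, map_mul, Complex.conj_ofReal]
  have : ((z - x : ℝ) : ℂ) * (E₂ - E₁) * (((y - x : ℝ) : ℂ) * conj (E₂ - E₁)) =
      (((z - x) * (y - x) : ℝ) : ℂ) * ((E₂ - E₁) * conj (E₂ - E₁)) := by
    push_cast; ring
  rw [this, Complex.mul_conj, Complex.im_ofReal_mul, Complex.ofReal_im, mul_zero]

/-- Two side functionals of the same line are proportional: if `X ≠ X'` lie on the line `E₁E₂`
then `sideFn X X' = κ · sideFn E₁ E₂` for a real `κ ≠ 0`. [folklore] -/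
theorem exists_sideFn_eq_mul {E₁ E₂ X X' : ℂ} (hE : E₁ ≠ E₂) (hX : sideFn E₁ E₂ X = 0)
    (hX' : sideFn E₁ E₂ X' = 0) (hne : X ≠ X') :
    ∃ κ : ℝ, κ ≠ 0 ∧ ∀ Y, sideFn X X' Y = κ * sideFn E₁ E₂ Y := by
  obtain ⟨a, rfl⟩ := eq_add_real_mul_of_sideFn_eq_zero hE hX
  obtain ⟨b, rfl⟩ := eq_add_real_mul_of_sideFn_eq_zero hE hX'
  have hab : b - a ≠ 0 := by
    intro h
    apply hne
    have : b = a := by linarith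
    rw [this]
  refine ⟨b - a, hab, fun Y => ?_⟩
  simp only [sideFn]
  have h1 : E₁ + (b : ℂ) * (E₂ - E₁) - (E₁ + (a : ℂ) * (E₂ - E₁)) = ((b - a : ℝ) : ℂ) * (E₂ - E₁) := by
    push_cast; ring
  rw [h1, map_mul, Complex.conj_ofReal]
  have : (Y - (E₁ + (a : ℂ) * (E₂ - E₁))) * (((b - a : ℝ) : ℂ) * conj (E₂ - E₁))
      = ((b - a : ℝ) : ℂ) * ((Y - E₁) * conj (E₂ - E₁)) -
          (((b - a) * a : ℝ) : ℂ) * ((E₂ - E₁) * conj (E₂ - E₁)) := by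
    push_cast; ring
  rw [this, Complex.sub_im, Complex.im_ofReal_mul, Complex.mul_conj, Complex.im_ofReal_mul,
    Complex.ofReal_im, mul_zero, sub_zero]

/-- A unit vector on the line of a unit vector is `±` that vector: if `‖u‖ = ‖e‖ = 1` and
`Im (u ē) = 0` then `u = e` or `u = -e`. [folklore] -/
theorem eq_or_eq_neg_of_im_eq_zero {u e : ℂ} (hu : ‖u‖ = 1) (he : ‖e‖ = 1)
    (him : (u * conj e).im = 0) : u = e ∨ u = -e := by
  have he0 : e ≠ 0 := by rintro rfl; simp at he
  have hA : sideFn 0 e u = 0 := by simpa [sideFn] using him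
  obtain ⟨t, ht⟩ := eq_add_real_mul_of_sideFn_eq_zero (A := 0) (P := e) (Ne.symm he0) hA
  simp only [zero_add, sub_zero] at ht
  have : |t| = 1 := by
    have h := congrArg norm ht
    rw [hu, norm_mul, Complex.norm_real, he, mul_one, Real.norm_eq_abs] at h
    exact h.symm
  rcases abs_eq (zero_le_one) |>.1 this with h | h
  · left; rw [ht, h]; simp
  · right; rw [ht, h]; simp

end SideFn

/-! ### The quadrilateral `A P B Q` and its oblique coordinates -/

section Quad

variable {A B P Q : ℂ}

/-- The hypotheses on the quadrilateral `A P B Q` used throughout: the diagonals bisect each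
other (`P + Q = A + B`, so it is a parallelogram with `B = P + Q - A`), it is non-degenerate
(`A ≠ B`, `P ≠ Q`) and the sides at `P` have unit length — the rhombus of a dart of an isoradial
embedding (`dart_isQuad`). (Grimmett–Manolescu 2014, §2.1, the rhombus `A O₁ B O₂`.)
[cite: GrimmettManolescu2014Isoradial, §2.1 (the rhombus A O₁ B O₂)] -/
structure IsQuad (A P B Q : ℂ) : Prop where
  sum : P + Q = A + B
  A_ne_B : A ≠ B
  P_ne_Q : P ≠ Q
  norm_AP : ‖A - P‖ = 1
  norm_BP : ‖B - P‖ = 1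

namespace IsQuad

/-- Re-labelling `A ↔ B`. [folklore] -/
theorem swapAB (h : IsQuad A P B Q) : IsQuad B P A Q :=
  ⟨by rw [h.sum, add_comm], h.A_ne_B.symm, h.P_ne_Q, h.norm_BP, h.norm_AP⟩

/-- Re-labelling `P ↔ Q`. [folklore] -/
theorem swapPQ (h : IsQuad A P B Q) : IsQuad A Q B P := by
  refine ⟨by rw [add_comm, h.sum], h.A_ne_B, h.P_ne_Q.symm, ?_, ?_⟩
  · have : A - Q = P - B := by linear_combination (-1 : ℂ) * h.sum
    rw [this, norm_sub_rev, h.norm_BP]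
  · have : B - Q = P - A := by linear_combination (-1 : ℂ) * h.sum
    rw [this, norm_sub_rev, h.norm_AP]

/-- The hull is unchanged by `A ↔ B`. [folklore] -/
theorem hull_swapAB (A P B Q : ℂ) :
    convexHull ℝ ({B, P, A, Q} : Set ℂ) = convexHull ℝ ({A, P, B, Q} : Set ℂ) := by
  congr 1; ext X; simp only [mem_insert_iff, mem_singleton_iff]; tauto

/-- The hull is unchanged by `P ↔ Q`. [folklore] -/
theorem hull_swapPQ (A P B Q : ℂ) :
    convexHull ℝ ({A, Q, B, P} : Set ℂ) = convexHull ℝ ({A, P, B, Q} : Set ℂ) := by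
  congr 1; ext X; simp only [mem_insert_iff, mem_singleton_iff]; tauto

/-- All four sides have unit length: `‖A - Q‖ = 1`. [folklore] -/
theorem norm_AQ (h : IsQuad A P B Q) : ‖A - Q‖ = 1 := h.swapPQ.norm_AP

/-- All four sides have unit length: `‖B - Q‖ = 1`. [folklore] -/
theorem norm_BQ (h : IsQuad A P B Q) : ‖B - Q‖ = 1 := h.swapPQ.norm_BP

/-- `A ≠ P`. [folklore] -/
theorem A_ne_P (h : IsQuad A P B Q) : A ≠ P := by
  intro hAP; have := h.norm_AP; rw [hAP, sub_self, norm_zero] at this; exact zero_ne_one this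

/-- `A ≠ Q`. [folklore] -/
theorem A_ne_Q (h : IsQuad A P B Q) : A ≠ Q := h.swapPQ.A_ne_P

/-- `B ≠ P`. [folklore] -/
theorem B_ne_P (h : IsQuad A P B Q) : B ≠ P := h.swapAB.A_ne_P

/-- `B ≠ Q`. [folklore] -/
theorem B_ne_Q (h : IsQuad A P B Q) : B ≠ Q := h.swapAB.swapPQ.A_ne_P

/-- `B = P + Q - A`. [folklore] -/
theorem B_eq (h : IsQuad A P B Q) : B = A + (P - A) + (Q - A) := by linear_combination h.sum.symm

/-- **The determinant** `D = sideFn A Q P = Im ((P - A) conj (Q - A))` is non-zero (the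
parallelogram is non-degenerate: `sideFn A P B ≠ 0` by `sideFn_B_ne_zero` below, and
`sideFn A Q P = -sideFn A P Q = -sideFn A P B`). [folklore] -/
theorem sideFn_APB (h : IsQuad A P B Q) : sideFn A P B = sideFn A P Q := by
  simp only [sideFn]
  have hQ : B - A = (P - A) + (Q - A) := by linear_combination h.sum.symm
  rw [hQ, add_mul, Complex.add_im, Complex.mul_conj, Complex.ofReal_im, zero_add]

/-- The value at `B` of the side functional of `AQ` equals its value at `P`. [folklore] -/
theorem sideFn_AQB (h : IsQuad A P B Q) : sideFn A Q B = sideFn A Q P := h.swapPQ.sideFn_APB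

/-- Non-degeneracy: `sideFn A P B ≠ 0` (the diagonals are perpendicular and non-zero, so `B`
is off the line `AP`). [folklore] -/
theorem sideFn_APB_ne_zero (h : IsQuad A P B Q) : sideFn A P B ≠ 0 := by
  obtain ⟨hn, horth⟩ := rhombus_halfDiag h.sum h.norm_AP h.norm_BP
  set a : ℂ := (A - B) / 2 with ha
  set p : ℂ := (P - Q) / 2 with hp
  have ha0 : a ≠ 0 := by
    simp only [ha]; intro h0
    rcases div_eq_zero_iff.1 h0 with h0 | h0
    · exact h.A_ne_B (sub_eq_zero.1 h0)
    · norm_num at h0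
  have hp0 : p ≠ 0 := by
    simp only [hp]; intro h0
    rcases div_eq_zero_iff.1 h0 with h0 | h0
    · exact h.P_ne_Q (sub_eq_zero.1 h0)
    · norm_num at h0
  have h1 : B - A = -2 * a := by simp only [ha]; ring
  have h2 : P - A = p - a := by simp only [ha, hp]; linear_combination (1 / 2 : ℂ) * h.sum
  simp only [sideFn, h1, h2, map_sub]
  have h3 : (-2 * a * (conj p - conj a)).im = -2 * (a * conj p).im := by
    have : -2 * a * (conj p - conj a) = -2 * (a * conj p) + 2 * (a * conj a) := by ring
    rw [this, Complex.add_im, Complex.mul_conj]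
    simp
  rw [h3]
  intro h0
  have him : (a * conj p).im = 0 := by linarith
  have hzero : a * conj p = 0 := Complex.ext (by simpa using horth) (by simpa using him)
  rcases mul_eq_zero.1 hzero with h0 | h0
  · exact ha0 h0
  · exact hp0 ((map_eq_zero _).1 h0)

/-- The determinant `sideFn A Q P` is non-zero. [folklore] -/
theorem det_ne_zero (h : IsQuad A P B Q) : sideFn A Q P ≠ 0 := by
  rw [← h.sideFn_AQB]; exact h.swapPQ.sideFn_APB_ne_zero

/-- `sideFn A P Q = - sideFn A Q P`. [folklore] -/
theorem sideFn_APQ (A P Q : ℂ) : sideFn A P Q = -sideFn A Q P := sideFn_swap A Q P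

end IsQuad

/-- **Oblique coordinates.** The coordinate of `Y` along `P - A` in the frame
`(A; P - A, Q - A)`: `Y = A + coordP · (P - A) + coordQ · (Q - A)` (`eq_coord`). [folklore] -/
def coordP (A P Q Y : ℂ) : ℝ := sideFn A Q Y / sideFn A Q P

/-- The coordinate of `Y` along `Q - A` in the frame `(A; P - A, Q - A)`. [folklore] -/
def coordQ (A P Q Y : ℂ) : ℝ := sideFn A P Y / sideFn A P Q

/-- **Decomposition in oblique coordinates**: `Y = A + α (P - A) + β (Q - A)` with
`α = coordP`, `β = coordQ` (Cramer's rule; needs the non-degeneracy `sideFn A Q P ≠ 0`).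
[folklore] -/
theorem eq_coord (hD : sideFn A Q P ≠ 0) (Y : ℂ) :
    Y = A + (coordP A P Q Y : ℂ) * (P - A) + (coordQ A P Q Y : ℂ) * (Q - A) := by
  have key : ((sideFn A Q P : ℝ) : ℂ) * (Y - A) =
      ((sideFn A Q Y : ℝ) : ℂ) * (P - A) - ((sideFn A P Y : ℝ) : ℂ) * (Q - A) :=
    cross_identity (P - A) (Q - A) (Y - A)
  have hD' : ((sideFn A Q P : ℝ) : ℂ) ≠ 0 := by exact_mod_cast hD
  have hneg : sideFn A P Q = -sideFn A Q P := IsQuad.sideFn_APQ A P Q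
  set D := sideFn A Q P with hDdef
  set a := sideFn A Q Y
  set b := sideFn A P Y
  simp only [coordP, coordQ, hneg, ← hDdef, Complex.ofReal_div, Complex.ofReal_neg]
  rw [← sub_eq_zero]
  have : Y - (A + (a : ℂ) / (D : ℂ) * (P - A) + (b : ℂ) / -(D : ℂ) * (Q - A)) =
      ((D : ℂ) * (Y - A) - ((a : ℂ) * (P - A) - (b : ℂ) * (Q - A))) / (D : ℂ) := by
    field_simp
    ring
  rw [this, key, sub_self, zero_div]

/-- Coordinates of `A`: `(0, 0)`. [folklore] -/
@[simp] theorem coordP_A (A P Q : ℂ) : coordP A P Q A = 0 := by simp [coordP]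

/-- Coordinates of `A`: `(0, 0)`. [folklore] -/
@[simp] theorem coordQ_A (A P Q : ℂ) : coordQ A P Q A = 0 := by simp [coordQ]

/-- Coordinates of `P`: `(1, 0)`. [folklore] -/
theorem coordP_P (hD : sideFn A Q P ≠ 0) : coordP A P Q P = 1 := by simp [coordP, hD]

/-- Coordinates of `P`: `(1, 0)`. [folklore] -/
@[simp] theorem coordQ_P (A P Q : ℂ) : coordQ A P Q P = 0 := by simp [coordQ]

/-- Coordinates of `Q`: `(0, 1)`. [folklore] -/
@[simp] theorem coordP_Q (A P Q : ℂ) : coordP A P Q Q = 0 := by simp [coordP]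

/-- Coordinates of `Q`: `(0, 1)`. [folklore] -/
theorem coordQ_Q (hD : sideFn A Q P ≠ 0) : coordQ A P Q Q = 1 := by
  have : sideFn A P Q ≠ 0 := by rw [IsQuad.sideFn_APQ]; exact neg_ne_zero.2 hD
  simp [coordQ, this]

/-- Coordinates of `B`: `(1, 1)`. [folklore] -/
theorem coordP_B (h : IsQuad A P B Q) : coordP A P Q B = 1 := by
  rw [coordP, h.sideFn_AQB, div_self h.det_ne_zero]

/-- Coordinates of `B`: `(1, 1)`. [folklore] -/
theorem coordQ_B (h : IsQuad A P B Q) : coordQ A P Q B = 1 := by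
  have : sideFn A P Q ≠ 0 := by rw [IsQuad.sideFn_APQ]; exact neg_ne_zero.2 h.det_ne_zero
  rw [coordQ, h.sideFn_APB, div_self this]

/-- `coordP` is affine. [folklore] -/
theorem coordP_combo (A P Q X Y : ℂ) {u v : ℝ} (huv : u + v = 1) :
    coordP A P Q (u • X + v • Y) = u * coordP A P Q X + v * coordP A P Q Y := by
  simp only [coordP, sideFn_combo A Q X Y huv]; ring

/-- `coordQ` is affine. [folklore] -/
theorem coordQ_combo (A P Q X Y : ℂ) {u v : ℝ} (huv : u + v = 1) :
    coordQ A P Q (u • X + v • Y) = u * coordQ A P Q X + v * coordQ A P Q Y := by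
  simp only [coordQ, sideFn_combo A P X Y huv]; ring

/-- `coordP` is continuous. [folklore] -/
theorem continuous_coordP (A P Q : ℂ) : Continuous fun Y => coordP A P Q Y :=
  (continuous_sideFn A Q).div_const _

/-- `coordQ` is continuous. [folklore] -/
theorem continuous_coordQ (A P Q : ℂ) : Continuous fun Y => coordQ A P Q Y :=
  (continuous_sideFn A P).div_const _

/-- The coordinates of the point with prescribed coordinates. [folklore] -/
theorem coordP_of_eq (hD : sideFn A Q P ≠ 0) (α β : ℝ) :
    coordP A P Q (A + (α : ℂ) * (P - A) + (β : ℂ) * (Q - A)) = α := by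
  unfold coordP
  have h1 : sideFn A Q (A + (α : ℂ) * (P - A) + (β : ℂ) * (Q - A)) = α * sideFn A Q P := by
    rw [sideFn_add_smul, sideFn_add_smul, sideFn_left, Complex.mul_conj, Complex.ofReal_im,
      mul_zero, add_zero, zero_add]
    rfl
  rw [h1, mul_div_assoc, div_self hD, mul_one]

/-- The coordinates of the point with prescribed coordinates. [folklore] -/
theorem coordQ_of_eq (hD : sideFn A Q P ≠ 0) (α β : ℝ) :
    coordQ A P Q (A + (α : ℂ) * (P - A) + (β : ℂ) * (Q - A)) = β := by
  unfold coordQ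
  have hD' : sideFn A P Q ≠ 0 := by rw [IsQuad.sideFn_APQ]; exact neg_ne_zero.2 hD
  have h1 : sideFn A P (A + (α : ℂ) * (P - A) + (β : ℂ) * (Q - A)) = β * sideFn A P Q := by
    rw [sideFn_add_smul, sideFn_add_smul, sideFn_left, Complex.mul_conj, Complex.ofReal_im,
      mul_zero, zero_add, zero_add]
    rfl
  rw [h1, mul_div_assoc, div_self hD', mul_one]

/-- **The parallelogram is the unit square in oblique coordinates.**
`conv{A, P, B, Q} = {Y | coordP Y ∈ [0, 1] ∧ coordQ Y ∈ [0, 1]}`. [folklore] -/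
theorem convexHull_quad_eq_coord (h : IsQuad A P B Q) :
    convexHull ℝ ({A, P, B, Q} : Set ℂ) =
      {Y | coordP A P Q Y ∈ Icc (0 : ℝ) 1 ∧ coordQ A P Q Y ∈ Icc (0 : ℝ) 1} := by
  have hD := h.det_ne_zero
  apply subset_antisymm
  · refine convexHull_min ?_ ?_
    · intro X hX
      simp only [mem_insert_iff, mem_singleton_iff] at hX
      rcases hX with rfl | rfl | rfl | rfl
      · simp
      · simp [coordP_P hD]
      · simp [coordP_B h, coordQ_B h]
      · simp [coordQ_Q hD]
    · intro X hX Y hY u v hu hv huv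
      simp only [mem_setOf_eq, mem_Icc] at hX hY ⊢
      rw [coordP_combo A P Q X Y huv, coordQ_combo A P Q X Y huv]
      refine ⟨⟨by nlinarith [hX.1.1, hY.1.1], by nlinarith [hX.1.2, hY.1.2]⟩,
        ⟨by nlinarith [hX.2.1, hY.2.1], by nlinarith [hX.2.2, hY.2.2]⟩⟩
  · intro Y hY
    simp only [mem_setOf_eq, mem_Icc] at hY
    obtain ⟨⟨hα0, hα1⟩, ⟨hβ0, hβ1⟩⟩ := hY
    set α := coordP A P Q Y with hα
    set β := coordQ A P Q Y with hβ
    obtain ⟨hAin, hPin, hBin, hQin⟩ := corners_mem_convexHull_quad A P B Q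
    have hconv : Convex ℝ (convexHull ℝ ({A, P, B, Q} : Set ℂ)) := convex_convexHull ℝ _
    have key : ((1 - α) * (1 - β)) • A + (α * (1 - β)) • P + (α * β) • B + ((1 - α) * β) • Q ∈
        convexHull ℝ ({A, P, B, Q} : Set ℂ) := by
      have hmem := hconv.sum_mem (t := Finset.univ)
        (w := ![(1 - α) * (1 - β), α * (1 - β), α * β, (1 - α) * β]) (z := ![A, P, B, Q])
        (by intro i _; fin_cases i <;> simp <;> nlinarith)
        (by simp [Fin.sum_univ_four]; ring)
        (by intro i _; fin_cases i <;> simp [hAin, hPin, hBin, hQin])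
      simpa [Fin.sum_univ_four] using hmem
    have hYeq : Y = ((1 - α) * (1 - β)) • A + (α * (1 - β)) • P + (α * β) • B +
        ((1 - α) * β) • Q := by
      rw [h.B_eq]
      conv_lhs => rw [eq_coord hD Y]
      simp only [Complex.real_smul, ← hα, ← hβ]
      push_cast
      ring
    rw [hYeq]
    exact key

/-- **The side `[A, P]` in coordinates**: `coordQ = 0` and `coordP ∈ [0, 1]`. [folklore] -/
theorem segment_eq_coord (hD : sideFn A Q P ≠ 0) :
    segment ℝ A P = {Y | sideFn A P Y = 0 ∧ coordP A P Q Y ∈ Icc (0 : ℝ) 1} := by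
  apply subset_antisymm
  · intro Y hY
    rw [segment_eq_image] at hY
    obtain ⟨θ, ⟨hθ0, hθ1⟩, rfl⟩ := hY
    refine ⟨?_, ?_⟩
    · rw [sideFn_combo A P A P (by ring : (1 - θ) + θ = 1)]; simp
    · rw [coordP_combo A P Q A P (by ring : (1 - θ) + θ = 1), coordP_A, coordP_P hD]
      constructor <;> nlinarith
  · rintro Y ⟨h0, hα0, hα1⟩
    have hβ : coordQ A P Q Y = 0 := by simp [coordQ, h0]
    rw [segment_eq_image]
    refine ⟨coordP A P Q Y, ⟨hα0, hα1⟩, ?_⟩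
    conv_rhs => rw [eq_coord hD Y]
    simp only [hβ, Complex.real_smul]
    push_cast
    ring

/-- **The open side `(A, P)` in coordinates**: `coordQ = 0` and `coordP ∈ (0, 1)`. [folklore] -/
theorem openSegment_eq_coord (hD : sideFn A Q P ≠ 0) :
    openSegment ℝ A P = {Y | sideFn A P Y = 0 ∧ coordP A P Q Y ∈ Ioo (0 : ℝ) 1} := by
  apply subset_antisymm
  · intro Y hY
    rw [openSegment_eq_image] at hY
    obtain ⟨θ, ⟨hθ0, hθ1⟩, rfl⟩ := hY
    refine ⟨?_, ?_⟩
    · rw [sideFn_combo A P A P (by ring : (1 - θ) + θ = 1)]; simp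
    · rw [coordP_combo A P Q A P (by ring : (1 - θ) + θ = 1), coordP_A, coordP_P hD]
      constructor <;> nlinarith
  · rintro Y ⟨h0, hα0, hα1⟩
    have hβ : coordQ A P Q Y = 0 := by simp [coordQ, h0]
    rw [openSegment_eq_image]
    refine ⟨coordP A P Q Y, ⟨hα0, hα1⟩, ?_⟩
    conv_rhs => rw [eq_coord hD Y]
    simp only [hβ, Complex.real_smul]
    push_cast
    ring

/-- The inner half-plane of the side `AP` in coordinates: `0 ≤ sideFn A P Y · sideFn A P B` iff
`0 ≤ coordQ Y`. [folklore] -/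
theorem inner_iff_coordQ_nonneg (h : IsQuad A P B Q) (Y : ℂ) :
    0 ≤ sideFn A P Y * sideFn A P B ↔ 0 ≤ coordQ A P Q Y := by
  have hne : sideFn A P Q ≠ 0 := by rw [← h.sideFn_APB]; exact h.sideFn_APB_ne_zero
  have hsq : 0 < sideFn A P Q * sideFn A P Q := mul_self_pos.2 hne
  rw [coordQ, h.sideFn_APB]
  constructor
  · intro h0
    rw [div_nonneg_iff]
    rcases lt_or_gt_of_ne hne with hneg | hpos
    · right; exact ⟨by nlinarith, hneg.le⟩
    · left; exact ⟨by nlinarith, hpos.le⟩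
  · intro h0
    have : sideFn A P Y * sideFn A P Q = (sideFn A P Y / sideFn A P Q) *
        (sideFn A P Q * sideFn A P Q) := by field_simp
    rw [this]; positivity

/-- The strict inner half-plane in coordinates: `0 < sideFn A P Y · sideFn A P B` iff
`0 < coordQ Y`. [folklore] -/
theorem strictInner_iff_coordQ_pos (h : IsQuad A P B Q) (Y : ℂ) :
    0 < sideFn A P Y * sideFn A P B ↔ 0 < coordQ A P Q Y := by
  have hne : sideFn A P Q ≠ 0 := by rw [← h.sideFn_APB]; exact h.sideFn_APB_ne_zero
  have hsq : 0 < sideFn A P Q * sideFn A P Q := mul_self_pos.2 hne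
  rw [coordQ, h.sideFn_APB]
  constructor
  · intro h0
    rw [div_pos_iff]
    rcases lt_or_gt_of_ne hne with hneg | hpos
    · right; exact ⟨by nlinarith, hneg⟩
    · left; exact ⟨by nlinarith, hpos⟩
  · intro h0
    have : sideFn A P Y * sideFn A P Q = (sideFn A P Y / sideFn A P Q) *
        (sideFn A P Q * sideFn A P Q) := by field_simp
    rw [this]; positivity

/-! ### Supporting half-plane and half-discs -/

/-- **The rhombus lies on the side of `B` of the line through its side `AP`**: for every point
`X` of `conv{A, P, B, Q}`, `sideFn A P X` has the (weak) sign of `sideFn A P B`.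
[cite: GrimmettManolescu2014Isoradial, §2.1 (the rhombus A O₁ B O₂)] -/
theorem convexHull_quad_subset_halfPlane (hsum : P + Q = A + B) :
    convexHull ℝ ({A, P, B, Q} : Set ℂ) ⊆ {X | 0 ≤ sideFn A P X * sideFn A P B} := by
  have hBQ : sideFn A P B = sideFn A P Q := by
    simp only [sideFn]
    have hQ : B - A = (P - A) + (Q - A) := by linear_combination hsum.symm
    rw [hQ, add_mul, Complex.add_im, Complex.mul_conj, Complex.ofReal_im, zero_add]
  refine convexHull_min ?_ ?_
  · intro X hX
    simp only [mem_insert_iff, mem_singleton_iff] at hX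
    simp only [mem_setOf_eq]
    rcases hX with rfl | rfl | rfl | rfl
    · simp
    · simp
    · exact mul_self_nonneg _
    · rw [hBQ]; exact mul_self_nonneg _
  · intro X hX Y hY u v hu hv huv
    simp only [mem_setOf_eq] at hX hY ⊢
    rw [sideFn_combo A P X Y huv, add_mul]
    have h1 : 0 ≤ u * (sideFn A P X * sideFn A P B) := mul_nonneg hu hX
    have h2 : 0 ≤ v * (sideFn A P Y * sideFn A P B) := mul_nonneg hv hY
    nlinarith

/-- **Half-discs at open side points.** Every point `X` of the open side `(A, P)` has a
neighbourhood whose intersection with the closed inner half-plane of `AP` lies in the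
parallelogram, and whose intersection with the open inner half-plane lies in its interior.
[cite: GrimmettManolescu2014Isoradial, §2.1 (the rhombus A O₁ B O₂)] -/
theorem exists_ball_inter_halfPlane_subset_quad (h : IsQuad A P B Q) {X : ℂ}
    (hX : X ∈ openSegment ℝ A P) :
    ∃ r > 0, ball X r ∩ {Y | 0 ≤ sideFn A P Y * sideFn A P B} ⊆ convexHull ℝ ({A, P, B, Q} : Set ℂ) ∧
      ball X r ∩ {Y | 0 < sideFn A P Y * sideFn A P B} ⊆
        interior (convexHull ℝ ({A, P, B, Q} : Set ℂ)) := by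
  have hD := h.det_ne_zero
  rw [openSegment_eq_coord hD] at hX
  obtain ⟨h0, hα0, hα1⟩ := hX
  have hβX : coordQ A P Q X = 0 := by simp [coordQ, h0]
  -- the open set `U = {0 < α < 1, β < 1}` contains `X`
  set U : Set ℂ := {Y | coordP A P Q Y ∈ Ioo (0 : ℝ) 1 ∧ coordQ A P Q Y < 1} with hU
  have hUo : IsOpen U :=
    (isOpen_Ioo.preimage (continuous_coordP A P Q)).inter
      (isOpen_Iio.preimage (continuous_coordQ A P Q))
  have hXU : X ∈ U := ⟨⟨hα0, hα1⟩, by rw [hβX]; exact zero_lt_one⟩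
  obtain ⟨r, hr, hrU⟩ := Metric.isOpen_iff.1 hUo X hXU
  have hK := convexHull_quad_eq_coord h
  have hsub : ball X r ∩ {Y | 0 ≤ sideFn A P Y * sideFn A P B} ⊆
      convexHull ℝ ({A, P, B, Q} : Set ℂ) := by
    rintro Y ⟨hY, hYH⟩
    obtain ⟨⟨h1, h2⟩, h3⟩ := hrU hY
    rw [mem_setOf_eq, inner_iff_coordQ_nonneg h] at hYH
    rw [hK]
    exact ⟨⟨h1.le, h2.le⟩, ⟨hYH, h3.le⟩⟩
  refine ⟨r, hr, hsub, ?_⟩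
  refine interior_maximal ?_ (Metric.isOpen_ball.inter ?_)
  · rintro Y ⟨hY, hYH⟩
    have hYH' : 0 ≤ sideFn A P Y * sideFn A P B := le_of_lt hYH
    exact hsub ⟨hY, hYH'⟩
  · exact isOpen_lt continuous_const ((continuous_sideFn A P).mul continuous_const)

/-! ### Topology of the parallelogram -/

/-- The parallelogram is closed. [folklore] -/
theorem isClosed_quad (A P B Q : ℂ) : IsClosed (convexHull ℝ ({A, P, B, Q} : Set ℂ)) :=
  (Set.toFinite _).isClosed_convexHull ℝ

/-- The centre is an interior point. [folklore] -/
theorem centre_mem_interior_quad (h : IsQuad A P B Q) :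
    (A + B) / 2 ∈ interior (convexHull ℝ ({A, P, B, Q} : Set ℂ)) := by
  have hball := ball_subset_convexHull_rhombus h.sum h.A_ne_B h.P_ne_Q h.norm_AP h.norm_BP
  refine mem_interior_of_ball_subset ?_ hball
  have ha : 0 < ‖(A - B) / 2‖ := by
    rw [norm_pos_iff]; intro h0
    rcases div_eq_zero_iff.1 h0 with h0 | h0
    · exact h.A_ne_B (sub_eq_zero.1 h0)
    · norm_num at h0
  have hp : 0 < ‖(P - Q) / 2‖ := by
    rw [norm_pos_iff]; intro h0
    rcases div_eq_zero_iff.1 h0 with h0 | h0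
    · exact h.P_ne_Q (sub_eq_zero.1 h0)
    · norm_num at h0
  positivity

/-- **The parallelogram is the closure of its interior** (a convex body). [folklore] -/
theorem subset_closure_interior_quad (h : IsQuad A P B Q) :
    convexHull ℝ ({A, P, B, Q} : Set ℂ) ⊆ closure (interior (convexHull ℝ ({A, P, B, Q} : Set ℂ))) := by
  rw [(convex_convexHull ℝ _).closure_interior_eq_closure_of_nonempty_interior
    ⟨_, centre_mem_interior_quad h⟩]
  exact subset_closure

/-- **How disjointness of interiors is used.** If a point of the parallelogram `K` lies in the
interior of a set `K'`, the two interiors meet. [folklore] -/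
theorem interior_inter_nonempty (h : IsQuad A P B Q) {K' : Set ℂ} {Y : ℂ}
    (hY : Y ∈ convexHull ℝ ({A, P, B, Q} : Set ℂ)) (hY' : Y ∈ interior K') :
    (interior (convexHull ℝ ({A, P, B, Q} : Set ℂ)) ∩ interior K').Nonempty := by
  have hcl := subset_closure_interior_quad h hY
  rw [mem_closure_iff_nhds] at hcl
  obtain ⟨Z, hZ, hZ'⟩ := hcl (interior K') (isOpen_interior.mem_nhds hY')
  exact ⟨Z, hZ', hZ⟩

/-- A parallelogram is not contained in a line: if `sideFn E₁ E₂` vanishes on it then `E₁ = E₂`.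
[folklore] -/
theorem not_subset_line (h : IsQuad A P B Q) {E₁ E₂ : ℂ} (hE : E₁ ≠ E₂)
    (hsub : convexHull ℝ ({A, P, B, Q} : Set ℂ) ⊆ {Y | sideFn E₁ E₂ Y = 0}) : False := by
  obtain ⟨hAin, hPin, -, hQin⟩ := corners_mem_convexHull_quad A P B Q
  have := sideFn_of_mem_line hE (hsub hAin) (hsub hQin) (hsub hPin)
  exact h.det_ne_zero this

/-- No corner of the parallelogram lies in its open side `(A, P)`. [folklore] -/
theorem corner_not_mem_openSegment (h : IsQuad A P B Q) {C : ℂ}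
    (hC : C = A ∨ C = P ∨ C = B ∨ C = Q) : C ∉ openSegment ℝ A P := by
  have hD := h.det_ne_zero
  rw [openSegment_eq_coord hD]
  rintro ⟨h0, hα0, hα1⟩
  rcases hC with hC | hC | hC | hC <;> rw [hC] at h0 hα0 hα1
  · simp at hα0
  · rw [coordP_P hD] at hα1; exact lt_irrefl _ hα1
  · exact h.sideFn_APB_ne_zero h0
  · rw [← h.sideFn_APB] at h0
    exact h.sideFn_APB_ne_zero h0

/-! ### Across a side -/

/-- **Across a side.** Let `K = conv{A, P, B, Q}` and let `K'` be a convex set, equal to the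
closure of its interior, whose interior is disjoint from that of `K`. If `K'` contains a point
of the open side `(A, P)` of `K`, then `K'` lies in the closed *outer* half-plane of that side.
(Two tiles of a tiling sharing a boundary point interior to a side of one of them lie on
opposite sides of that side.) [cite: GrimmettManolescu2014Isoradial, §4.1 (rhombic tilings of the plane)] -/
theorem subset_outer_of_mem_openSegment (h : IsQuad A P B Q) {K' : Set ℂ} (hK' : Convex ℝ K')
    (hK'cl : K' ⊆ closure (interior K'))
    (hdisj : Disjoint (interior (convexHull ℝ ({A, P, B, Q} : Set ℂ))) (interior K'))
    {m : ℂ} (hm : m ∈ openSegment ℝ A P) (hmK' : m ∈ K') :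
    K' ⊆ {Y | sideFn A P Y * sideFn A P B ≤ 0} := by
  intro q hq
  rw [mem_setOf_eq]
  by_contra hpos
  push Not at hpos
  obtain ⟨r, hr, -, hint⟩ := exists_ball_inter_halfPlane_subset_quad h hm
  have hm0 : sideFn A P m = 0 := by
    rw [openSegment_eq_coord h.det_ne_zero] at hm; exact hm.1
  -- a point of `(m, q]` close to `m`
  have hqm : 0 < ‖q - m‖ + 1 := by positivity
  set t : ℝ := min (1 / 2) (r / (2 * (‖q - m‖ + 1))) with ht
  have ht0 : 0 < t := by positivity
  have ht1 : t < 1 := lt_of_le_of_lt (min_le_left _ _) (by norm_num)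
  set y : ℂ := (1 - t) • m + t • q with hy
  have hyK' : y ∈ K' := hK' hmK' hq (by linarith) ht0.le (by ring)
  have hyball : y ∈ ball m r := by
    rw [mem_ball, dist_eq_norm]
    have : y - m = t • (q - m) := by simp only [hy, Complex.real_smul]; push_cast; ring
    rw [this, norm_smul, Real.norm_eq_abs, abs_of_pos ht0]
    calc t * ‖q - m‖ ≤ r / (2 * (‖q - m‖ + 1)) * ‖q - m‖ :=
          mul_le_mul_of_nonneg_right (min_le_right _ _) (norm_nonneg _)
      _ ≤ r / (2 * (‖q - m‖ + 1)) * (‖q - m‖ + 1) := by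
          apply mul_le_mul_of_nonneg_left (by linarith) (by positivity)
      _ = r / 2 := by field_simp
      _ < r := by linarith
  have hypos : 0 < sideFn A P y * sideFn A P B := by
    rw [hy, sideFn_combo A P m q (by ring : (1 - t) + t = 1), hm0, mul_zero, zero_add, mul_assoc]
    exact mul_pos ht0 hpos
  have hyint : y ∈ interior (convexHull ℝ ({A, P, B, Q} : Set ℂ)) := hint ⟨hyball, hypos⟩
  -- `y ∈ K'` is in the closure of `interior K'`, and `interior K` is a neighbourhood of `y`
  have hcl := hK'cl hyK'
  rw [mem_closure_iff_nhds] at hcl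
  obtain ⟨Z, hZ, hZ'⟩ := hcl _ (isOpen_interior.mem_nhds hyint)
  exact Set.disjoint_left.1 hdisj hZ hZ'

/-! ### Faces in a supporting line -/

/-- An affine functional of the plane in oblique coordinates: bilinear interpolation of its
corner values is exact. For `g = s · sideFn E₁ E₂` and `Y = A + α (P - A) + β (Q - A)`:
`g Y = (1-α)(1-β) g A + α(1-β) g P + αβ g B + (1-α)β g Q`. [folklore] -/
theorem sideFn_coord_expand (h : IsQuad A P B Q) (E₁ E₂ : ℂ) (Y : ℂ) :
    sideFn E₁ E₂ Y =
      (1 - coordP A P Q Y) * (1 - coordQ A P Q Y) * sideFn E₁ E₂ A +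
      coordP A P Q Y * (1 - coordQ A P Q Y) * sideFn E₁ E₂ P +
      coordP A P Q Y * coordQ A P Q Y * sideFn E₁ E₂ B +
      (1 - coordP A P Q Y) * coordQ A P Q Y * sideFn E₁ E₂ Q := by
  have hD := h.det_ne_zero
  set α := coordP A P Q Y with hα
  set β := coordQ A P Q Y with hβ
  have hY : Y = A + (α : ℂ) * (P - A) + (β : ℂ) * (Q - A) := eq_coord hD Y
  have hB : B = A + (P - A) + (Q - A) := h.B_eq
  -- everything is an explicit polynomial identity in the real and imaginary parts
  rw [hY, hB]
  simp only [sideFn, Complex.mul_im, Complex.sub_re, Complex.sub_im, Complex.add_re,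
    Complex.add_im, Complex.mul_re, Complex.ofReal_re, Complex.ofReal_im, Complex.conj_re,
    Complex.conj_im]
  ring

/-- **Faces in a supporting line.** Suppose the parallelogram `K = conv{A, P, B, Q}` lies in the
closed half-plane `{s · sideFn E₁ E₂ ≤ 0}` (`s ≠ 0`, `E₁ ≠ E₂`) and meets the line `E₁E₂` in two
distinct points. Then it meets the line exactly in one of its sides `[C, C']` with `C ∈ {A, B}`
and `C' ∈ {P, Q}` (a face of a polygon in a supporting line is a vertex or a side; two opposite
corners on the line would put the centre, hence all four corners, on it).
[cite: GrimmettManolescu2014Isoradial, §4.1 (rhombic tilings of the plane)] -/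
theorem quad_face (h : IsQuad A P B Q) {E₁ E₂ : ℂ} (hE : E₁ ≠ E₂) {s : ℝ} (hs : s ≠ 0)
    (hle : ∀ C, (C = A ∨ C = P ∨ C = B ∨ C = Q) → s * sideFn E₁ E₂ C ≤ 0)
    {Y₁ Y₂ : ℂ} (hY₁ : Y₁ ∈ convexHull ℝ ({A, P, B, Q} : Set ℂ))
    (hY₂ : Y₂ ∈ convexHull ℝ ({A, P, B, Q} : Set ℂ)) (hne : Y₁ ≠ Y₂)
    (h1 : sideFn E₁ E₂ Y₁ = 0) (h2 : sideFn E₁ E₂ Y₂ = 0) :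
    ∃ C C', (C = A ∨ C = B) ∧ (C' = P ∨ C' = Q) ∧ sideFn E₁ E₂ C = 0 ∧ sideFn E₁ E₂ C' = 0 ∧
      convexHull ℝ ({A, P, B, Q} : Set ℂ) ∩ {Y | sideFn E₁ E₂ Y = 0} = segment ℝ C C' := by
  have hD := h.det_ne_zero
  have hK := convexHull_quad_eq_coord h
  -- corner values of `g = s · sideFn`
  set gA := s * sideFn E₁ E₂ A with hgA
  set gP := s * sideFn E₁ E₂ P with hgP
  set gB := s * sideFn E₁ E₂ B with hgB
  set gQ := s * sideFn E₁ E₂ Q with hgQ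
  have hA0 : gA ≤ 0 := hle A (Or.inl rfl)
  have hP0 : gP ≤ 0 := hle P (Or.inr (Or.inl rfl))
  have hB0 : gB ≤ 0 := hle B (Or.inr (Or.inr (Or.inl rfl)))
  have hQ0 : gQ ≤ 0 := hle Q (Or.inr (Or.inr (Or.inr rfl)))
  -- `g = 0 ↔ sideFn = 0`
  have hg0 : ∀ Y, s * sideFn E₁ E₂ Y = 0 ↔ sideFn E₁ E₂ Y = 0 := fun Y => by
    constructor
    · intro h0; rcases mul_eq_zero.1 h0 with h0 | h0
      · exact absurd h0 hs
      · exact h0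
    · intro h0; rw [h0, mul_zero]
  -- the four term decomposition at a zero `Y ∈ K`
  have hterms : ∀ Y ∈ convexHull ℝ ({A, P, B, Q} : Set ℂ), sideFn E₁ E₂ Y = 0 →
      (1 - coordP A P Q Y) * (1 - coordQ A P Q Y) * gA = 0 ∧
      coordP A P Q Y * (1 - coordQ A P Q Y) * gP = 0 ∧
      coordP A P Q Y * coordQ A P Q Y * gB = 0 ∧
      (1 - coordP A P Q Y) * coordQ A P Q Y * gQ = 0 := by
    intro Y hY hY0
    rw [hK] at hY
    obtain ⟨⟨hα0, hα1⟩, ⟨hβ0, hβ1⟩⟩ := hY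
    have hexp := sideFn_coord_expand h E₁ E₂ Y
    rw [hY0] at hexp
    have hexp' : 0 = (1 - coordP A P Q Y) * (1 - coordQ A P Q Y) * gA +
        coordP A P Q Y * (1 - coordQ A P Q Y) * gP +
        coordP A P Q Y * coordQ A P Q Y * gB +
        (1 - coordP A P Q Y) * coordQ A P Q Y * gQ := by
      simp only [hgA, hgP, hgB, hgQ]
      have := congrArg (fun x => s * x) hexp
      simp only [mul_zero] at this
      rw [this]; ring
    have t1 : (1 - coordP A P Q Y) * (1 - coordQ A P Q Y) * gA ≤ 0 :=
      mul_nonpos_of_nonneg_of_nonpos (mul_nonneg (by linarith) (by linarith)) hA0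
    have t2 : coordP A P Q Y * (1 - coordQ A P Q Y) * gP ≤ 0 :=
      mul_nonpos_of_nonneg_of_nonpos (mul_nonneg hα0 (by linarith)) hP0
    have t3 : coordP A P Q Y * coordQ A P Q Y * gB ≤ 0 :=
      mul_nonpos_of_nonneg_of_nonpos (mul_nonneg hα0 hβ0) hB0
    have t4 : (1 - coordP A P Q Y) * coordQ A P Q Y * gQ ≤ 0 :=
      mul_nonpos_of_nonneg_of_nonpos (mul_nonneg (by linarith) hβ0) hQ0
    refine ⟨by linarith, by linarith, by linarith, by linarith⟩
  -- the collinearity obstruction: not both `A, B` (resp. `P, Q`) on the line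
  have hApB : gA + gB = gP + gQ := by
    simp only [hgA, hgB, hgP, hgQ, sideFn]
    have : (B - E₁) * conj (E₂ - E₁) = (P - E₁) * conj (E₂ - E₁) + (Q - E₁) * conj (E₂ - E₁)
        - (A - E₁) * conj (E₂ - E₁) := by
      have hB : B = P + Q - A := by linear_combination h.sum.symm
      rw [hB]; ring
    rw [this, Complex.sub_im, Complex.add_im]; ring
  have notAB : ¬ (gA = 0 ∧ gB = 0) := by
    rintro ⟨ha, hb⟩
    have hp : gP = 0 := by linarith
    have hq : gQ = 0 := by linarith
    have := sideFn_of_mem_line hE ((hg0 A).1 ha) ((hg0 Q).1 hq) ((hg0 P).1 hp)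
    exact hD this
  have notPQ : ¬ (gP = 0 ∧ gQ = 0) := by
    rintro ⟨hp, hq⟩
    have ha : gA = 0 := by linarith
    have := sideFn_of_mem_line hE ((hg0 A).1 ha) ((hg0 Q).1 hq) ((hg0 P).1 hp)
    exact hD this
  -- coordinates of the two zeros
  obtain ⟨a1, p1, b1, q1⟩ := hterms Y₁ hY₁ h1
  obtain ⟨a2, p2, b2, q2⟩ := hterms Y₂ hY₂ h2
  have hY₁K := hY₁; have hY₂K := hY₂
  rw [hK] at hY₁K hY₂K
  obtain ⟨⟨hα10, hα11⟩, ⟨hβ10, hβ11⟩⟩ := hY₁K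
  obtain ⟨⟨hα20, hα21⟩, ⟨hβ20, hβ21⟩⟩ := hY₂K
  have hY₁eq := eq_coord hD Y₁
  have hY₂eq := eq_coord hD Y₂
  set α₁ := coordP A P Q Y₁; set β₁ := coordQ A P Q Y₁
  set α₂ := coordP A P Q Y₂; set β₂ := coordQ A P Q Y₂
  -- segments in coordinates (for the final description of the face)
  have hsegK : ∀ {C C' : ℂ}, (C = A ∨ C = P ∨ C = B ∨ C = Q) → (C' = A ∨ C' = P ∨ C' = B ∨ C' = Q) →
      sideFn E₁ E₂ C = 0 → sideFn E₁ E₂ C' = 0 →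
      segment ℝ C C' ⊆ convexHull ℝ ({A, P, B, Q} : Set ℂ) ∩ {Y | sideFn E₁ E₂ Y = 0} := by
    intro C C' hC hC' hC0 hC'0
    obtain ⟨hAin, hPin, hBin, hQin⟩ := corners_mem_convexHull_quad A P B Q
    have hCin : C ∈ convexHull ℝ ({A, P, B, Q} : Set ℂ) := by
      rcases hC with rfl | rfl | rfl | rfl <;> assumption
    have hC'in : C' ∈ convexHull ℝ ({A, P, B, Q} : Set ℂ) := by
      rcases hC' with rfl | rfl | rfl | rfl <;> assumption
    refine subset_inter ((convex_convexHull ℝ _).segment_subset hCin hC'in) ?_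
    intro Y hY
    rw [segment_eq_image] at hY
    obtain ⟨θ, -, rfl⟩ := hY
    simp only [mem_setOf_eq]
    rw [sideFn_combo E₁ E₂ C C' (by ring : (1 - θ) + θ = 1), hC0, hC'0]; ring
  -- Case analysis on which of `A, B` and which of `P, Q` lie on the line.
  -- First: one of `gA, gB` vanishes.
  have hAB : gA = 0 ∨ gB = 0 := by
    by_contra hcon
    push Not at hcon
    have hA' : gA < 0 := lt_of_le_of_ne hA0 hcon.1
    have hB' : gB < 0 := lt_of_le_of_ne hB0 hcon.2
    -- then `(1-α)(1-β) = 0` and `αβ = 0` at both zeros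
    have e1 : (1 - α₁) * (1 - β₁) = 0 := by
      rcases mul_eq_zero.1 a1 with h0 | h0
      · exact h0
      · exact absurd h0 hA'.ne
    have e2 : α₁ * β₁ = 0 := by
      rcases mul_eq_zero.1 b1 with h0 | h0
      · exact h0
      · exact absurd h0 hB'.ne
    have e3 : (1 - α₂) * (1 - β₂) = 0 := by
      rcases mul_eq_zero.1 a2 with h0 | h0
      · exact h0
      · exact absurd h0 hA'.ne
    have e4 : α₂ * β₂ = 0 := by
      rcases mul_eq_zero.1 b2 with h0 | h0
      · exact h0
      · exact absurd h0 hB'.ne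
    -- one of `gP, gQ` is `< 0`, the other `= 0` (not both zero, not both `< 0`)
    rcases eq_or_lt_of_le hP0 with hp | hp <;> rcases eq_or_lt_of_le hQ0 with hq | hq
    · exact notPQ ⟨hp, hq⟩
    · -- `gP = 0`, `gQ < 0`: both zeros are `P`
      have f1 : (1 - α₁) * β₁ = 0 := by
        rcases mul_eq_zero.1 q1 with h0 | h0
        · exact h0
        · exact absurd h0 hq.ne
      have f2 : (1 - α₂) * β₂ = 0 := by
        rcases mul_eq_zero.1 q2 with h0 | h0
        · exact h0
        · exact absurd h0 hq.ne
      have hb1 : β₁ = 0 := by linear_combination e2 + f1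
      have ha1 : α₁ = 1 := by linear_combination (-1 : ℝ) * e1 - (1 - α₁) * hb1
      have hb2 : β₂ = 0 := by linear_combination e4 + f2
      have ha2 : α₂ = 1 := by linear_combination (-1 : ℝ) * e3 - (1 - α₂) * hb2
      apply hne
      rw [hY₁eq, hY₂eq, ha1, hb1, ha2, hb2]
    · -- `gP < 0`, `gQ = 0`: both zeros are `Q`
      have f1 : α₁ * (1 - β₁) = 0 := by
        rcases mul_eq_zero.1 p1 with h0 | h0
        · exact h0
        · exact absurd h0 hp.ne
      have f2 : α₂ * (1 - β₂) = 0 := by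
        rcases mul_eq_zero.1 p2 with h0 | h0
        · exact h0
        · exact absurd h0 hp.ne
      have ha1 : α₁ = 0 := by linear_combination f1 + e2
      have hb1 : β₁ = 1 := by linear_combination (-1 : ℝ) * e1 - (1 - β₁) * ha1
      have ha2 : α₂ = 0 := by linear_combination f2 + e4
      have hb2 : β₂ = 1 := by linear_combination (-1 : ℝ) * e3 - (1 - β₂) * ha2
      apply hne
      rw [hY₁eq, hY₂eq, ha1, hb1, ha2, hb2]
    · -- all four weights vanish: impossible
      have f1 : α₁ * (1 - β₁) = 0 := by
        rcases mul_eq_zero.1 p1 with h0 | h0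
        · exact h0
        · exact absurd h0 hp.ne
      have f2 : (1 - α₁) * β₁ = 0 := by
        rcases mul_eq_zero.1 q1 with h0 | h0
        · exact h0
        · exact absurd h0 hq.ne
      have h10 : (1 : ℝ) = 0 := by linear_combination e1 + e2 + f1 + f2
      exact one_ne_zero h10
  -- Second: one of `gP, gQ` vanishes (same argument with the roles exchanged).
  have hPQ : gP = 0 ∨ gQ = 0 := by
    by_contra hcon
    push Not at hcon
    have hP' : gP < 0 := lt_of_le_of_ne hP0 hcon.1
    have hQ' : gQ < 0 := lt_of_le_of_ne hQ0 hcon.2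
    have e1 : α₁ * (1 - β₁) = 0 := by
      rcases mul_eq_zero.1 p1 with h0 | h0
      · exact h0
      · exact absurd h0 hP'.ne
    have e2 : (1 - α₁) * β₁ = 0 := by
      rcases mul_eq_zero.1 q1 with h0 | h0
      · exact h0
      · exact absurd h0 hQ'.ne
    have e3 : α₂ * (1 - β₂) = 0 := by
      rcases mul_eq_zero.1 p2 with h0 | h0
      · exact h0
      · exact absurd h0 hP'.ne
    have e4 : (1 - α₂) * β₂ = 0 := by
      rcases mul_eq_zero.1 q2 with h0 | h0
      · exact h0
      · exact absurd h0 hQ'.ne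
    rcases eq_or_lt_of_le hA0 with ha | ha <;> rcases eq_or_lt_of_le hB0 with hb | hb
    · exact notAB ⟨ha, hb⟩
    · -- `gA = 0`, `gB < 0`: both zeros are `A`
      have f1 : α₁ * β₁ = 0 := by
        rcases mul_eq_zero.1 b1 with h0 | h0
        · exact h0
        · exact absurd h0 hb.ne
      have f2 : α₂ * β₂ = 0 := by
        rcases mul_eq_zero.1 b2 with h0 | h0
        · exact h0
        · exact absurd h0 hb.ne
      have ha1 : α₁ = 0 := by linear_combination e1 + f1
      have hb1 : β₁ = 0 := by linear_combination e2 + f1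
      have ha2 : α₂ = 0 := by linear_combination e3 + f2
      have hb2 : β₂ = 0 := by linear_combination e4 + f2
      apply hne
      rw [hY₁eq, hY₂eq, ha1, hb1, ha2, hb2]
    · -- `gA < 0`, `gB = 0`: both zeros are `B`
      have f1 : (1 - α₁) * (1 - β₁) = 0 := by
        rcases mul_eq_zero.1 a1 with h0 | h0
        · exact h0
        · exact absurd h0 ha.ne
      have f2 : (1 - α₂) * (1 - β₂) = 0 := by
        rcases mul_eq_zero.1 a2 with h0 | h0
        · exact h0
        · exact absurd h0 ha.ne
      have ha1 : α₁ = 1 := by linear_combination (-1 : ℝ) * f1 - e2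
      have hb1 : β₁ = 1 := by linear_combination (-1 : ℝ) * f1 - e1
      have ha2 : α₂ = 1 := by linear_combination (-1 : ℝ) * f2 - e4
      have hb2 : β₂ = 1 := by linear_combination (-1 : ℝ) * f2 - e3
      apply hne
      rw [hY₁eq, hY₂eq, ha1, hb1, ha2, hb2]
    · have f1 : (1 - α₁) * (1 - β₁) = 0 := by
        rcases mul_eq_zero.1 a1 with h0 | h0
        · exact h0
        · exact absurd h0 ha.ne
      have f2 : α₁ * β₁ = 0 := by
        rcases mul_eq_zero.1 b1 with h0 | h0
        · exact h0
        · exact absurd h0 hb.ne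
      have h10 : (1 : ℝ) = 0 := by linear_combination f1 + f2 + e1 + e2
      exact one_ne_zero h10
  -- Now the four cases `(C, C') ∈ {A, B} × {P, Q}`.
  have hzero : ∀ Y ∈ convexHull ℝ ({A, P, B, Q} : Set ℂ), sideFn E₁ E₂ Y = 0 →
      Y = A + (coordP A P Q Y : ℂ) * (P - A) + (coordQ A P Q Y : ℂ) * (Q - A) ∧
      (coordP A P Q Y ∈ Icc (0:ℝ) 1 ∧ coordQ A P Q Y ∈ Icc (0:ℝ) 1) := fun Y hY _ =>
    ⟨eq_coord hD Y, by rw [hK] at hY; exact hY⟩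
  rcases hAB with ha | hb <;> rcases hPQ with hp | hq
  · -- `(A, P)`: `gB < 0`, `gQ < 0`, zeros have `β = 0`
    have hb : gB < 0 := lt_of_le_of_ne hB0 fun h0 => notAB ⟨ha, h0⟩
    have hq : gQ < 0 := lt_of_le_of_ne hQ0 fun h0 => notPQ ⟨hp, h0⟩
    refine ⟨A, P, Or.inl rfl, Or.inl rfl, (hg0 A).1 ha, (hg0 P).1 hp, ?_⟩
    apply subset_antisymm _ (hsegK (Or.inl rfl) (Or.inr (Or.inl rfl)) ((hg0 A).1 ha) ((hg0 P).1 hp))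
    rintro Y ⟨hY, hY0⟩
    obtain ⟨-, -, b0, q0⟩ := hterms Y hY hY0
    obtain ⟨hYeq, ⟨hα0, hα1⟩, ⟨hβ0, hβ1⟩⟩ := hzero Y hY hY0
    have e1 : coordP A P Q Y * coordQ A P Q Y = 0 := by
      rcases mul_eq_zero.1 b0 with h0 | h0
      · exact h0
      · exact absurd h0 hb.ne
    have e2 : (1 - coordP A P Q Y) * coordQ A P Q Y = 0 := by
      rcases mul_eq_zero.1 q0 with h0 | h0
      · exact h0
      · exact absurd h0 hq.ne
    have hβ : coordQ A P Q Y = 0 := by linear_combination e1 + e2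
    rw [segment_eq_image]
    refine ⟨coordP A P Q Y, ⟨hα0, hα1⟩, ?_⟩
    conv_rhs => rw [hYeq, hβ]
    simp only [Complex.real_smul]; push_cast; ring
  · -- `(A, Q)`: zeros have `α = 0`
    have hb : gB < 0 := lt_of_le_of_ne hB0 fun h0 => notAB ⟨ha, h0⟩
    have hp : gP < 0 := lt_of_le_of_ne hP0 fun h0 => notPQ ⟨h0, hq⟩
    refine ⟨A, Q, Or.inl rfl, Or.inr rfl, (hg0 A).1 ha, (hg0 Q).1 hq, ?_⟩
    apply subset_antisymm _ (hsegK (Or.inl rfl) (Or.inr (Or.inr (Or.inr rfl))) ((hg0 A).1 ha)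
      ((hg0 Q).1 hq))
    rintro Y ⟨hY, hY0⟩
    obtain ⟨-, p0, b0, -⟩ := hterms Y hY hY0
    obtain ⟨hYeq, ⟨hα0, hα1⟩, ⟨hβ0, hβ1⟩⟩ := hzero Y hY hY0
    have e1 : coordP A P Q Y * coordQ A P Q Y = 0 := by
      rcases mul_eq_zero.1 b0 with h0 | h0
      · exact h0
      · exact absurd h0 hb.ne
    have e2 : coordP A P Q Y * (1 - coordQ A P Q Y) = 0 := by
      rcases mul_eq_zero.1 p0 with h0 | h0
      · exact h0
      · exact absurd h0 hp.ne
    have hα : coordP A P Q Y = 0 := by linear_combination e1 + e2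
    rw [segment_eq_image]
    refine ⟨coordQ A P Q Y, ⟨hβ0, hβ1⟩, ?_⟩
    conv_rhs => rw [hYeq, hα]
    simp only [Complex.real_smul]; push_cast; ring
  · -- `(B, P)`: zeros have `α = 1`
    have ha : gA < 0 := lt_of_le_of_ne hA0 fun h0 => notAB ⟨h0, hb⟩
    have hq : gQ < 0 := lt_of_le_of_ne hQ0 fun h0 => notPQ ⟨hp, h0⟩
    refine ⟨B, P, Or.inr rfl, Or.inl rfl, (hg0 B).1 hb, (hg0 P).1 hp, ?_⟩
    apply subset_antisymm _ (hsegK (Or.inr (Or.inr (Or.inl rfl))) (Or.inr (Or.inl rfl))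
      ((hg0 B).1 hb) ((hg0 P).1 hp))
    rintro Y ⟨hY, hY0⟩
    obtain ⟨a0, -, -, q0⟩ := hterms Y hY hY0
    obtain ⟨hYeq, ⟨hα0, hα1⟩, ⟨hβ0, hβ1⟩⟩ := hzero Y hY hY0
    have e1 : (1 - coordP A P Q Y) * (1 - coordQ A P Q Y) = 0 := by
      rcases mul_eq_zero.1 a0 with h0 | h0
      · exact h0
      · exact absurd h0 ha.ne
    have e2 : (1 - coordP A P Q Y) * coordQ A P Q Y = 0 := by
      rcases mul_eq_zero.1 q0 with h0 | h0
      · exact h0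
      · exact absurd h0 hq.ne
    have hα : coordP A P Q Y = 1 := by linear_combination (-1 : ℝ) * e1 - e2
    rw [segment_eq_image]
    refine ⟨1 - coordQ A P Q Y, ⟨by linarith, by linarith⟩, ?_⟩
    conv_rhs => rw [hYeq, hα]
    rw [h.B_eq]; simp only [Complex.real_smul]; push_cast; ring
  · -- `(B, Q)`: zeros have `β = 1`
    have ha : gA < 0 := lt_of_le_of_ne hA0 fun h0 => notAB ⟨h0, hb⟩
    have hp : gP < 0 := lt_of_le_of_ne hP0 fun h0 => notPQ ⟨h0, hq⟩
    refine ⟨B, Q, Or.inr rfl, Or.inr rfl, (hg0 B).1 hb, (hg0 Q).1 hq, ?_⟩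
    apply subset_antisymm _ (hsegK (Or.inr (Or.inr (Or.inl rfl))) (Or.inr (Or.inr (Or.inr rfl)))
      ((hg0 B).1 hb) ((hg0 Q).1 hq))
    rintro Y ⟨hY, hY0⟩
    obtain ⟨a0, p0, -, -⟩ := hterms Y hY hY0
    obtain ⟨hYeq, ⟨hα0, hα1⟩, ⟨hβ0, hβ1⟩⟩ := hzero Y hY hY0
    have e1 : (1 - coordP A P Q Y) * (1 - coordQ A P Q Y) = 0 := by
      rcases mul_eq_zero.1 a0 with h0 | h0
      · exact h0
      · exact absurd h0 ha.ne
    have e2 : coordP A P Q Y * (1 - coordQ A P Q Y) = 0 := by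
      rcases mul_eq_zero.1 p0 with h0 | h0
      · exact h0
      · exact absurd h0 hp.ne
    have hβ : coordQ A P Q Y = 1 := by linear_combination (-1 : ℝ) * e1 - e2
    rw [segment_eq_image]
    refine ⟨1 - coordP A P Q Y, ⟨by linarith, by linarith⟩, ?_⟩
    conv_rhs => rw [hYeq, hβ]
    rw [h.B_eq]; simp only [Complex.real_smul]; push_cast; ring

end Quad

end Literature.Probability.Percolation

end
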